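import Mathlib.Data.Complex.Basic
import Mathlib.RingTheory.MvPolynomial.WeightedHomogeneous
import Mathlib.RingTheory.MvPolynomial.Homogeneous
import Literature.Computability.AlgebraicComplexity.CircuitGateSemantics
import HarnessLib
import HarnessLib.Audit

/-!
# DepthWindow — the relative homogenisation block lemmas `HomRel k j` (g6, second layer under
the crux `HomSubReach` of route `route-ValiantsHypothesis-DepthWindow`)

The crux `HomSubReach` (item 23791) asks for homogenisation of an arbitrary product-depth-`Δ`
circuit computing a degree-`d` homogeneous polynomial at *slope* `≤ 7/5`: a circuit with every
gate homogeneous, product-depth `≤ (7/5)·Δ + O(1)` and size `poly(s, |σ|) · 2^{O(d²)}`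
(LST 2025, Lemma 11 gives slope `2`; slope `1` at one level is impossible by Nisan–Wigderson
1996; anything `≤ 7/5` closes the depth window against BDS 2024, Thm. 1.4).

This module TYPES the natural local form of that question and proves the bookkeeping that turns
it into the crux:

* `HomAt p q c₀ a` — homogenisation at slope `p/q` with explicit constants; the crux is literally
  `∃ p q c₀ a, 5p ≤ 7q ∧ HomAt p q c₀ a` (`HomSlope75`, see `homSlope75_iff`).
* `HomRel k j` — the **relative block lemma**: every gate list ("block") of relative
  product-depth `≤ k` over *weighted* variables (weights `≥ 1`: the inputs of a block are the
  homogeneous components, of positive degree, of the gates below it) has a weighted-homogeneous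
  gate list of product-depth `≤ j` and length `poly(block, inputs, d) · 2^{O(d²)}` containing, as
  operands, the weighted-homogeneous components of degree `≤ d` of *every* gate of the block
  (multi-output: this is what stacking consumes).  `HomRel 1 2` is LST 2025 Lemma 11 /
  Lemma 19–20 (Newton identities, print); `HomRel 1 1` is false (NW 1996, print); `HomRel k k'`
  for `k ≥ 2, k ≤ k' < 2k` is open — and `HomRel 2 2`, `HomRel 3 4`, `HomRel 5 7` each close the
  crux (`5j ≤ 7k`).
* `HomRelStacks` — the stacking statement (band decomposition of a depth-`Δ` circuit into
  `⌈Δ/k⌉` blocks of relative depth `k`, re-variabling the lower components with their degrees as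
  weights, truncation at degree `d`): `HomRel k j → ∃ c₀ a, HomAt j k c₀ a`.  PROVABLE-NOW
  bookkeeping (no mathematics beyond graded substitution), stated here as a `Prop` and left to a
  prover; it is NOT a literature fact.
* kernel: `homSlope75_of_homRel` (`HomRelStacks → 0 < k → 5j ≤ 7k → HomRel k j → HomSlope75`),
  the three named entry points `(2,2)`, `(3,4)`, `(5,7)`, and the trivial monotonicities of the
  family (`HomRel.of_le_left`, `HomRel.le_right`).

Content regime (critic g5): the statements have content only for `d² ≲ log s`; at high degree the
`2^{a d²}` factor lets brute-force `ΣΠ` expansion satisfy them whenever `|σ| ≤ 2^{a d}`.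

[cite: LimayeSrinivasanTavenas2025, Lemma 11, Lemma 12, Lemma 19, Lemma 20]
[cite: NisanWigderson1996, Thm. 1] [cite: BhargavDuttaSaxena2024, Thm. 1.4, Rem. 1.5]
-/

-- layout Summits/ValiantsHypothesis/ValiantsHypothesis forces the duplicated namespace component
set_option linter.dupNamespace false

namespace Summit.ValiantsHypothesis.ValiantsHypothesis.Theorems.DepthWindow

open MvPolynomial Literature.Computability.AlgebraicComplexity ArithCircuit

/-- **Homogenisation at slope `p/q` with constants `c₀, a`**: every product-depth-`Δ`, size-`s`
circuit computing a degree-`d` homogeneous `f` over `σ` has an every-gate-homogeneous circuit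
computing `f` of product-depth `≤ p·Δ/q + c₀` and size `≤ (s + |σ| + 2)^a · 2^{a d²}`
(LST 2025, Lemma 11 is `HomAt 2 1 c₀ a` for some `c₀ a`).
[cite: LimayeSrinivasanTavenas2025, Lemma 11] -/
@[conjecture] def HomAt (p q c₀ a : ℕ) : Prop :=
  ∀ (σ : Type) [Fintype σ] (d : ℕ) (f : MvPolynomial σ ℂ), f.IsHomogeneous d →
    ∀ D : ArithCircuit ℂ σ, D.Computes f → ∃ D' : ArithCircuit ℂ σ,
      D'.Computes f ∧ (∀ g ∈ ArithCircuit.gateValues D'.gates, ∃ e : ℕ, g.IsHomogeneous e) ∧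
      D'.productDepth ≤ p * D.productDepth / q + c₀ ∧
      D'.size ≤ (D.size + Fintype.card σ + 2) ^ a * 2 ^ (a * d * d)

/-- **Homogenisation at some slope `≤ 7/5`** — literally the crux `HomSubReach` of the route
`DepthWindow` (see `homSlope75_iff`, whose right-hand side is the crux verbatim).
[cite: LimayeSrinivasanTavenas2025, Lemma 11] [cite: BhargavDuttaSaxena2024, Thm. 1.4] -/
@[conjecture] def HomSlope75 : Prop := ∃ p q c₀ a : ℕ, 5 * p ≤ 7 * q ∧ HomAt p q c₀ a

/-- `HomSlope75` unfolds to the crux `HomSubReach` of route `DepthWindow` verbatim.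
[cite: LimayeSrinivasanTavenas2025, Lemma 11] -/
theorem homSlope75_iff : HomSlope75 ↔
    ∃ p q c₀ a : ℕ, 5 * p ≤ 7 * q ∧ ∀ (σ : Type) [Fintype σ] (d : ℕ) (f : MvPolynomial σ ℂ),
      f.IsHomogeneous d → ∀ D : ArithCircuit ℂ σ, D.Computes f → ∃ D' : ArithCircuit ℂ σ,
        D'.Computes f ∧ (∀ g ∈ ArithCircuit.gateValues D'.gates, ∃ e : ℕ, g.IsHomogeneous e) ∧
        D'.productDepth ≤ p * D.productDepth / q + c₀ ∧
        D'.size ≤ (D.size + Fintype.card σ + 2) ^ a * 2 ^ (a * d * d) :=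
  Iff.rfl

/-- **The relative homogenisation block lemma `HomRel k j`.**  For some exponent `a`, uniformly:
for every finite type `τ` of *weighted* variables with weights `w ≥ 1`, every truncation degree
`d` and every gate list `Φ` over `τ` all of whose gates have product-depth `≤ k` (relative depth
of the block), there is a gate list `Ψ` over `τ` whose gate values are all `w`-weighted
homogeneous, whose gates all have product-depth `≤ j`, of length
`≤ (|Φ| + |τ| + d + 2)^a · 2^{a d²}`, together with operands `out i e` (referring only to gates
of `Ψ`) evaluating to the `w`-weighted homogeneous component of weighted degree `e` of the value
of gate `i` of `Φ`, for every `i < |Φ|` and `e ≤ d`.  (`HomRel 1 2`: LST 2025, Lemma 11 /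
Lemmas 19–20, via Newton identities; `HomRel 1 1` fails by NW 1996; `HomRel k k'`, `k ≥ 2`,
`k ≤ k' < 2k`: open.) [cite: LimayeSrinivasanTavenas2025, Lemma 11, Lemma 19, Lemma 20]
[cite: NisanWigderson1996, Thm. 1] -/
@[conjecture] def HomRel (k j : ℕ) : Prop :=
  ∃ a : ℕ, ∀ (τ : Type) [Fintype τ] (w : τ → ℕ), (∀ t, 1 ≤ w t) → ∀ (d : ℕ)
    (Φ : List (ArithCircuit.Gate ℂ τ)),
    (∀ n ∈ ArithCircuit.gateWDepths ArithCircuit.prodWeight Φ, n ≤ k) →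
    ∃ (Ψ : List (ArithCircuit.Gate ℂ τ)) (out : ℕ → ℕ → ArithCircuit.Operand ℂ τ),
      (∀ g ∈ ArithCircuit.gateValues Ψ, ∃ e : ℕ, MvPolynomial.IsWeightedHomogeneous w g e) ∧
      (∀ n ∈ ArithCircuit.gateWDepths ArithCircuit.prodWeight Ψ, n ≤ j) ∧
      Ψ.length ≤ (Φ.length + Fintype.card τ + d + 2) ^ a * 2 ^ (a * d * d) ∧
      ∀ i e : ℕ, i < Φ.length → e ≤ d →
        (out i e).RefsBelow Ψ.length ∧
        (out i e).eval (ArithCircuit.gateValues Ψ) =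
          MvPolynomial.weightedHomogeneousComponent w e ((ArithCircuit.gateValues Φ).getD i 0)

/-- **Stacking** (PROVABLE-NOW bookkeeping, not a literature fact): cut a product-depth-`Δ` circuit
into `⌈Δ/k⌉` consecutive bands of relative product-depth `k`; feed band `b`, as weighted
variables, the homogeneous components of positive degree `≤ d` of the gates of the bands below
(weight = degree; degree-`0` components as constants); apply `HomRel k j` to each band and
substitute.  All gates stay homogeneous (graded substitution), the product-depth becomes
`≤ ⌈Δ/k⌉·j ≤ j·Δ/k + j`, the size `≤ (Δ/k + 1) · (s + |σ| + s d + d + 2)^a 2^{a d²}`, and the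
output is the degree-`d` component of the old output, i.e. `f` itself.  Hence `HomAt j k c₀ a'`.
[cite: LimayeSrinivasanTavenas2025, Lemma 19, Lemma 20] -/
@[conjecture] def HomRelStacks : Prop := ∀ k j : ℕ, 0 < k → HomRel k j → ∃ c₀ a : ℕ, HomAt j k c₀ a

/-- **Kernel composition**: a relative block lemma of slope `j/k ≤ 7/5` closes the crux, given
stacking. [cite: LimayeSrinivasanTavenas2025, Lemma 11] [cite: BhargavDuttaSaxena2024, Thm. 1.4] -/
theorem homSlope75_of_homRel (hs : HomRelStacks) {k j : ℕ} (hk : 0 < k) (hkj : 5 * j ≤ 7 * k)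
    (h : HomRel k j) : HomSlope75 := by
  obtain ⟨c₀, a, hAt⟩ := hs k j hk h
  exact ⟨j, k, c₀, a, hkj, hAt⟩

/-- Entry point `(k, j) = (2, 2)` (slope `1`; the most killable admissible block lemma: its
targets are homogeneous `ΣΠΣΠ` circuits, where shifted-partials lower bounds live).
[cite: LimayeSrinivasanTavenas2025, Lemma 11] -/
theorem homSlope75_of_homRel_2_2 (hs : HomRelStacks) (h : HomRel 2 2) : HomSlope75 :=
  homSlope75_of_homRel hs (by decide) (by decide) h

/-- Entry point `(k, j) = (3, 4)` (slope `4/3`). [cite: LimayeSrinivasanTavenas2025, Lemma 11] -/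
theorem homSlope75_of_homRel_3_4 (hs : HomRelStacks) (h : HomRel 3 4) : HomSlope75 :=
  homSlope75_of_homRel hs (by decide) (by decide) h

/-- Entry point `(k, j) = (5, 7)` (slope `7/5`, the weakest named admissible block lemma).
[cite: LimayeSrinivasanTavenas2025, Lemma 11] [cite: BhargavDuttaSaxena2024, Thm. 1.4] -/
theorem homSlope75_of_homRel_5_7 (hs : HomRelStacks) (h : HomRel 5 7) : HomSlope75 :=
  homSlope75_of_homRel hs (by decide) (by decide) h

/-- Monotonicity in the block depth: a block lemma for relative depth `k` covers blocks of
relative depth `k' ≤ k`. [cite: LimayeSrinivasanTavenas2025, Lemma 19] -/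
theorem HomRel.of_le_left {k k' j : ℕ} (hk : k' ≤ k) (h : HomRel k j) : HomRel k' j := by
  obtain ⟨a, ha⟩ := h
  refine ⟨a, fun τ _ w hw d Φ hΦ => ?_⟩
  exact ha τ w hw d Φ fun n hn => (hΦ n hn).trans hk

/-- Monotonicity in the target depth: depth `j` witnesses are depth-`j'` witnesses for `j ≤ j'`.
[cite: LimayeSrinivasanTavenas2025, Lemma 19] -/
theorem HomRel.le_right {k j j' : ℕ} (hj : j ≤ j') (h : HomRel k j) : HomRel k j' := by
  obtain ⟨a, ha⟩ := h
  refine ⟨a, fun τ _ w hw d Φ hΦ => ?_⟩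
  obtain ⟨Ψ, out, hhom, hdep, hlen, hout⟩ := ha τ w hw d Φ hΦ
  exact ⟨Ψ, out, hhom, fun n hn => (hdep n hn).trans hj, hlen, hout⟩

/-- The slope bookkeeping in one line: any admissible pair closes the crux, so the family's
decisive members are `(2,2)`, `(3,3)`, `(3,4)`, `(4,4)`, `(4,5)`, `(5,5)`, `(5,6)`, `(5,7)`, …;
by `HomRel.le_right` the weakest at each `k ≤ 5` are `(2,2)`, `(3,4)`, `(4,5)`, `(5,7)`.
[cite: LimayeSrinivasanTavenas2025, Lemma 11] -/
theorem homSlope75_of_homRel_weakest (hs : HomRelStacks)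
    (h : HomRel 2 2 ∨ HomRel 3 4 ∨ HomRel 4 5 ∨ HomRel 5 7) : HomSlope75 := by
  rcases h with h | h | h | h
  · exact homSlope75_of_homRel_2_2 hs h
  · exact homSlope75_of_homRel_3_4 hs h
  · exact homSlope75_of_homRel hs (by decide) (by decide) h
  · exact homSlope75_of_homRel_5_7 hs h

end Summit.ValiantsHypothesis.ValiantsHypothesis.Theorems.DepthWindow
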